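import Literature.AlgebraicGeometry.HodgeTheory.FermatHodgeCharacters
import HarnessLib

/-!
# Shioda's arithmetic condition `(Pₘ)` and the inductive spine of the Hodge conjecture for Fermat varieties

Family `hodge`, layer `Literature/AlgebraicGeometry/HodgeTheory`. Second arithmetic brick (after
`FermatHodgeCharacters`, whose vocabulary `FermatCharacter.normSum / IsHodge / IsPaired` it extends)
of the middle-degree case of the named fact `hodgeClasses_algebraic_fermat` (file
`FermatHodgeConjecture`; Shioda, Proc. Japan Acad. 55A (1979) §2 Thm. 1; Ran, Compositio Math. 42
(1980) Thm. 4.9): the Hodge conjecture for the Fermat variety `Xⁿₘ : x₀ᵐ + ⋯ + x_{n+1}ᵐ = 0`, `m`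
prime or `m ≤ 20`. Everything here is PROVED; no geometry enters. This file formalises SHIODA'S
line of proof (PJA §1–§2, §4), complementary to Ran's ruled joins:

> "By means of the inductive structure of `Xⁿₘ` with respect to `n`, we can reduce the proof of these
> conjectures to the verification of certain purely arithmetic conditions on `m`, `n`" (PJA, p. 111).
> **Theorem 1.** If the condition `(Pⁿₘ)` is satisfied, then the Hodge Conjecture for `Xⁿₘ` is true.
> The condition `(Pⁿₘ)` has been verified for 1) `m` prime, all `n`, 2) `m ≤ 20`, all `n`,
> 3) `m = 21`, `n ≤ 10` (PJA §2, p. 112).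

## Shioda's semigroup `Mₘ` and the condition `(Pₘ)` (PJA §1; da Silva 2021 §2)

Fix `m > 1`. `Mₘ` is the additive semigroup of non-negative integer solutions
`ξ = (x₁, …, x_{m-1}; y) ≠ 0` of `∑_ν ⟨tν⟩ x_ν = m y` for all `t ∈ (ℤ/m)ˣ` (`⟨a⟩ ∈ [1, m-1]` the
representative) together with `∑ ν x_ν ≡ 0 (mod m)`; `y = ‖ξ‖` is the length. A Hodge character
`α = (a₀, …, a_{n+1}) ∈ 𝔅ⁿₘ` (all `aᵢ ≠ 0`, `∑ aᵢ = 0`, `|tα| = n/2 + 1` for all units `t`; the tree's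
`FermatCharacter.IsHodge`) gives the element `{α} = (x₁(α), …, x_{m-1}(α); n/2 + 1)`, `x_ν(α)` the
number of coordinates equal to `ν`, and `{α} = {β}` iff `α ∼ β` up to a permutation of the
coordinates. HERE `Mₘ ∪ {0}` is the predicate `FermatCharacter.IsHodgeMultiset` on
`Multiset (ℤ/m)` — the multiset of values of the character IS the character up to permutation, and
`IsHodge α ↔ IsHodgeMultiset (values of α)` (`isHodge_iff_isHodgeMultiset`); the length is `#s / 2`
(`IsHodgeMultiset.even_card`). Shioda's Definition (PJA §1): `ξ` is *decomposable* if
`ξ = ξ' + ξ''` in `Mₘ`; *quasi-decomposable* if `ξ + η = ξ' + ξ''` with `η` of length `1` (a pair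
`{e, -e}`) and `ξ', ξ'' ∈ Mₘ` different from `ξ` (da Silva Def. 2.4; Shioda's (ii) allows
`‖η‖ ≤ 2`, see the faithfulness note at `IsQuasiDecomposable`); *semi-decomposable* (length `3`
only) if `x = x' + x''` with `x', x''` triples each summing to `0 mod m` (two characters of the
Fermat curve `X¹ₘ`). The condition, in the form uniform in `n` (PJA `(Pⁿₘ)'`; da Silva `(Pₘ)`):

`(Pₘ)`: every element of `Mₘ` of length `≥ 3` is decomposable, quasi-decomposable or
semi-decomposable (`ShiodaCondition m`; `ShiodaConditionUpTo m n` is `(Pⁿₘ)`, lengths `≤ n/2 + 1`).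

## What is proved

* `IsShiodaClosed.of_shiodaCondition(UpTo)` — **the inductive spine of Theorem 1**: if `(Pⁿₘ)`
  holds and a family `C` of multisets contains the pairs (dimension `0`), the Hodge multisets of
  cardinality `4` (dimension `2`: Lefschetz `(1,1)` on `X²ₘ`), the semi-decomposable ones
  (`X¹ₘ × X¹ₘ`), and is closed under juxtaposition `β' * γ'` (type II) and under `β # γ` (type I) —
  the five geometric inputs of PJA §4 / da Silva Cor. 2.3, recorded as the fields of
  `IsShiodaClosed C` with exactly the side conditions under which they are printed — then `C`
  contains every non-empty Hodge multiset with `≤ n + 2` elements. With `C = 𝔠ₘ` (Hodge characters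
  whose eigenspace `V(α) ⊂ Hⁿ(Xⁿₘ(ℂ); ℂ)` consists of algebraic classes) this is `(Pⁿₘ) ⇒ HC(Xⁿₘ)`.
  The proof is da Silva's remark "if `{α}` is quasi-decomposable then `α` satisfies `(P1)` or
  `(P2)`" made precise: from `s + {e,-e} = t + u` either `e ∈ t`, `-e ∈ u` and `s = t' # u'`
  (type I; `#t, #u ≥ 4` because `t, u ≠ s`), or `{e, -e} ≤ t` and `s = (t - {e,-e}) + u` is
  decomposable after all; strong induction on the cardinality.
* `forall_of_pairSplitting`, `forall_of_prime`, `forall_of_four` — when `Mₘ` is generated by its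
  elements of length `1` only the pairs and juxtaposition are needed (the shape of Ran's Thm. 4.9:
  "if `m` is prime, the Hodge subspace is generated by the homology classes of linear spaces").
* `shiodaCondition_of_prime` — **`(Pₚ)`, `p` prime** (PJA list item 1, "Parry"; da Silva Thm. 2.6):
  by the tree's `IsHodge.card_filter_eq_card_filter_neg` (Ran Prop. 1.8 (i) via Koblitz–Ogus and
  `L(0, χ) ≠ 0`) a Hodge multiset takes each value as often as its negative, so splits off a pair.
* `shiodaCondition_four` — **`(P₄)`** (da Silva Thm. 2.6): `x₃ = x₁`, `x₂` even.
* `shiodaCondition_six` — **`(P₆)`** (inside PJA list item 2): `2x₁ + x₂ = x₄ + 2x₅`; the only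
  elements of length `≥ 3` not split by `{3,3}`, `{1,5}`, `{2,4}` or by `{1,1,4,4,4,4}`,
  `{5,5,2,2,2,2}` are these two indecomposables of length `3`, which are quasi-decomposable
  (`+ {3,3} = {1,4,4,3} + {1,4,4,3}`) and semi-decomposable (`{1,1,4} + {4,4,4}`) — non-vacuity of
  all three alternatives of `(Pₘ)`.

## How this serves `hodgeClasses_algebraic_fermat`, and what is NOT here

Granted Lefschetz off the middle degree (`FermatHodgeConjectureProofs.hodgeClasses_algebraic_fermat_of_middle`),
the fact is its middle-degree case, which by Shioda's Theorem 1 is: (i) the character decomposition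
`(H^{p,p} ∩ H²ᵖ(X²ᵖₘ, ℚ)) ⊗ ℂ = V(0) ⊕ ⨁_{α ∈ 𝔅} V(α)` on the tree's carriers (eigenspaces:
`DiagonalCharacterEigenspace`; Hodge types of `V(α)`: NOT in the tree), (ii) the geometric closure
properties `IsShiodaClosed 𝔠ₘ` (the inductive structure `Xʳₘ × Xˢₘ ⇢ X^{r+s}ₘ` and its blow-up on
real cohomology, preserving algebraic classes; Lefschetz `(1,1)` for `X²ₘ` and `X¹ₘ × X¹ₘ` — the
tree's named fact `lefschetzOneOne_rational`; NOT in the tree otherwise), and (iii) the arithmetic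
`(Pₘ)` — HERE for `m` prime, `4`, `6`; the remaining `m ∈ {8, 9, 10, 12, 14, 15, 16, 18, 20}` of
Shioda's list item 2 are finite Hilbert-basis computations (da Silva §3, appendix; `φ(20) = 5`) not
yet done. No new named fact is introduced (D-0026): `ShiodaCondition m` is a predicate of `m`, true
for some `m` and false for others (`m = 25, 33`, da Silva Prop. 3.6).

## References

* [Shioda1979PJA] T. Shioda, The Hodge conjecture and the Tate conjecture for Fermat varieties,
  Proc. Japan Acad. 55A (1979) 111–114: §1 (`Mₘ(H)`, length, Definition (i)–(iii), conditions
  `(Pⁿₘ(H))`, `(Pⁿₘ(H))'`), §2 Thm. 1 and the list after it, §4 (text read, held copy pp. 1–4).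
* [daSilva2021HodgeFermat] G. da Silva Jr., Notes on the Hodge Conjecture for Fermat Varieties,
  Experimental Results 2 (2021), arXiv:2101.04739: §2 (`Mₘ`, the map `{ }`, Def. 2.4, Thm. 2.2,
  Cor. 2.3, Thm. 2.5, Thm. 2.6, Thm. 2.7), §3 (Prop. 3.6, table of `φ(m)`) (text read).
* [Shioda1979HodgeFermat] T. Shioda, The Hodge conjecture for Fermat varieties, Math. Ann. 245
  (1979) 175–184 (the detailed account; not held — cited through the two texts above).
* [Ran1980] Z. Ran, Cycles on Fermat hypersurfaces, Compositio Math. 42 (1980) 121–142, Prop. 1.8 (i),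
  Thm. 4.9.
* [KoblitzOgus1979] N. Koblitz, A. Ogus, Algebraicity of some products of values of the `Γ`
  function, Proc. Symp. Pure Math. 33.2 (1979) 343–346 (through `FermatHodgeCharacters`).
-/

noncomputable section

open Finset Multiset

namespace Literature.AlgebraicGeometry.HodgeTheory

namespace FermatCharacter

variable {m : ℕ}

/-! ### Hodge multisets: Shioda's semigroup `Mₘ` -/

/-- `∑ ⟨a⟩` over a multiset of residues (representatives in `[0, m-1]`): `m` times Shioda's length
`‖ξ‖` when the multiset is a Hodge multiset. [cite: Shioda1979PJA, §1 eq. (2)] -/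
def mNormSum (s : Multiset (ZMod m)) : ℕ := (s.map ZMod.val).sum

/-- **Shioda's semigroup `Mₘ`** (with `0` adjoined), as a predicate on multisets of residues mod `m`:
all elements non-zero, sum zero (Shioda's congruence (3)), and `2 ∑ ⟨t a⟩ = m · #s` for every unit
`t` (Shioda's equations (2) with `y = #s / 2` the length). A character `α : Fin r → ℤ/m` is a Hodge
character (`FermatCharacter.IsHodge`) iff its multiset of values is a Hodge multiset
(`isHodge_iff_isHodgeMultiset`): the multiset is the character up to permutation of the coordinates,
Shioda's `(x₁, …, x_{m-1}; y)` with `x_ν` the multiplicity of `ν`.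
[cite: Shioda1979PJA, §1 eqs. (2), (3) and the definition of `Mₘ(H)` (with `H = {1}`)]
[cite: daSilva2021HodgeFermat, §2, definition of `Mₘ` and the map `α ↦ {α}`] -/
def IsHodgeMultiset (s : Multiset (ZMod m)) : Prop :=
  ((∀ a ∈ s, a ≠ 0) ∧ s.sum = 0) ∧
    ∀ t : (ZMod m)ˣ, 2 * mNormSum (s.map fun a ↦ (t : ZMod m) * a) = m * card s

/-- The empty multiset has norm `0`. [folklore] -/
theorem mNormSum_zero : mNormSum (0 : Multiset (ZMod m)) = 0 := by simp [mNormSum]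

/-- The norm is additive (lengths add under juxtaposition). [cite: Shioda1979PJA, §1] -/
theorem mNormSum_add (s t : Multiset (ZMod m)) : mNormSum (s + t) = mNormSum s + mNormSum t := by
  simp [mNormSum, Multiset.map_add, Multiset.sum_add]

/-- The norm of `a ::ₘ s`. [folklore] -/
theorem mNormSum_cons (a : ZMod m) (s : Multiset (ZMod m)) :
    mNormSum (a ::ₘ s) = a.val + mNormSum s := by
  simp [mNormSum]

/-- `⟨a⟩ + ⟨-a⟩ = m`: a pair has norm `m`, i.e. length `1`. [cite: Shioda1979PJA, §1] -/
theorem mNormSum_pair [NeZero m] {a : ZMod m} (ha : a ≠ 0) :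
    mNormSum ({a, -a} : Multiset (ZMod m)) = m := by
  simp [mNormSum, Multiset.insert_eq_cons, val_add_val_neg ha]

/-- The empty multiset is a (degenerate) Hodge multiset. [folklore] -/
theorem IsHodgeMultiset.zero : IsHodgeMultiset (0 : Multiset (ZMod m)) := by
  refine ⟨⟨by simp, by simp⟩, fun t ↦ by simp [mNormSum]⟩

/-- Hodge multisets form a semigroup: `Mₘ` is closed under addition. [cite: Shioda1979PJA, §1] -/
theorem IsHodgeMultiset.add {s t : Multiset (ZMod m)} (hs : IsHodgeMultiset s) (ht : IsHodgeMultiset t) :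
    IsHodgeMultiset (s + t) := by
  refine ⟨⟨fun a ha ↦ ?_, ?_⟩, fun u ↦ ?_⟩
  · rcases Multiset.mem_add.1 ha with h | h
    · exact hs.1.1 a h
    · exact ht.1.1 a h
  · rw [Multiset.sum_add, hs.1.2, ht.1.2, add_zero]
  · rw [Multiset.map_add, mNormSum_add, Multiset.card_add, mul_add, mul_add, hs.2 u, ht.2 u]

/-- Cancellation: the complement of a Hodge sub-multiset of a Hodge multiset is a Hodge multiset
(the defining conditions are linear). [cite: Shioda1979PJA, §1] -/
theorem IsHodgeMultiset.of_add_left {s t : Multiset (ZMod m)} (hst : IsHodgeMultiset (s + t))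
    (hs : IsHodgeMultiset s) : IsHodgeMultiset t := by
  refine ⟨⟨fun a ha ↦ hst.1.1 a (Multiset.mem_add.2 (Or.inr ha)), ?_⟩, fun u ↦ ?_⟩
  · have h := hst.1.2
    rwa [Multiset.sum_add, hs.1.2, zero_add] at h
  · have h := hst.2 u
    rw [Multiset.map_add, mNormSum_add, Multiset.card_add, mul_add, mul_add, hs.2 u] at h
    exact Nat.add_left_cancel h

/-- The pair `{a, -a}`, `a ≠ 0` (a Hodge character of the zero-dimensional Fermat variety, Shioda's
elements of length `1`) is a Hodge multiset. [cite: Shioda1979PJA, §1 ("exactly [m/2] elements of length 1")] -/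
theorem IsHodgeMultiset.pair [NeZero m] {a : ZMod m} (ha : a ≠ 0) :
    IsHodgeMultiset ({a, -a} : Multiset (ZMod m)) := by
  refine ⟨⟨?_, by simp⟩, fun t ↦ ?_⟩
  · simp [ha]
  · have hta : (t : ZMod m) * a ≠ 0 := (Units.mul_right_eq_zero t).not.mpr ha
    have h2 : mNormSum (({a, -a} : Multiset (ZMod m)).map fun b ↦ (t : ZMod m) * b) = m := by
      simp only [Multiset.insert_eq_cons, Multiset.map_cons, Multiset.map_singleton, mul_neg]
      simp [mNormSum, val_add_val_neg hta]
    rw [h2]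
    simp [mul_comm]

/-- Removing a pair `{a, -a}` from a Hodge multiset leaves a Hodge multiset. [cite: Shioda1979PJA, §1] -/
theorem IsHodgeMultiset.of_pair_add [NeZero m] {a : ZMod m} {s : Multiset (ZMod m)}
    (h : IsHodgeMultiset ({a, -a} + s)) : IsHodgeMultiset s :=
  h.of_add_left (IsHodgeMultiset.pair (h.1.1 a (by simp)))

/-- A Hodge multiset has even cardinality (`n` is even): `2 ∑⟨a⟩ = m #s` and `∑ a = 0`.
[cite: Shioda1979PJA, §2 ("non-trivial only in case n is even")] -/
theorem IsHodgeMultiset.even_card [NeZero m] {s : Multiset (ZMod m)} (h : IsHodgeMultiset s) :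
    Even (card s) := by
  have h1 := h.2 1
  simp only [Units.val_one, one_mul, Multiset.map_id'] at h1
  -- `∑ ⟨a⟩ ≡ ∑ a = 0 (mod m)`, so `m ∣ mNormSum s`
  have hsum : ((mNormSum s : ℕ) : ZMod m) = s.sum := by
    simp [mNormSum]
  rw [h.1.2, ZMod.natCast_eq_zero_iff] at hsum
  obtain ⟨k, hk⟩ := hsum
  rw [hk] at h1
  have hm : 0 < m := Nat.pos_of_ne_zero (NeZero.ne m)
  have : 2 * k = card s := by
    apply Nat.eq_of_mul_eq_mul_left hm
    linarith [h1]
  exact ⟨k, by omega⟩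

/-- A non-empty Hodge multiset has at least two elements. [folklore] -/
theorem IsHodgeMultiset.two_le_card [NeZero m] {s : Multiset (ZMod m)} (h : IsHodgeMultiset s)
    (hs : s ≠ 0) : 2 ≤ card s := by
  obtain ⟨k, hk⟩ := h.even_card
  have : card s ≠ 0 := fun h0 ↦ hs (Multiset.card_eq_zero.1 h0)
  omega

/-- A Hodge multiset with two elements is a pair `{a, -a}`. [cite: Shioda1979PJA, §1] -/
theorem IsHodgeMultiset.eq_pair_of_card_eq_two {s : Multiset (ZMod m)} (h : IsHodgeMultiset s)
    (hs : card s = 2) : ∃ a, a ≠ 0 ∧ s = {a, -a} := by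
  obtain ⟨a, b, rfl⟩ := Multiset.card_eq_two.1 hs
  have hab : a + b = 0 := by simpa using h.1.2
  refine ⟨a, h.1.1 a (by simp), ?_⟩
  rw [eq_neg_of_add_eq_zero_right hab]


/-! ### Characters versus multisets of values -/

variable {r : ℕ}

/-- `m|α| = ∑ᵢ ⟨αᵢ⟩` is the norm of the multiset of values. [folklore] -/
theorem normSum_eq_mNormSum (α : Fin r → ZMod m) : normSum α = mNormSum (univ.val.map α) := by
  unfold normSum mNormSum
  rw [Finset.sum_eq_multiset_sum, Multiset.map_map]
  rfl

/-- The multiset of values of `α : Fin r → ℤ/m` has `r` elements. [folklore] -/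
theorem card_univ_val_map (α : Fin r → ZMod m) : card (univ.val.map α) = r := by
  rw [Multiset.card_map, Finset.card_val, Finset.card_univ, Fintype.card_fin]

/-- **A character is a Hodge character iff its multiset of values is a Hodge multiset**: Shioda's
passage from `𝔅ⁿₘ` to the semigroup `Mₘ` (`α ↦ (x₁(α), …, x_{m-1}(α); n/2 + 1)`, `x_ν(α)` the
number of coordinates with `⟨αᵢ⟩ = ν`). [cite: Shioda1979PJA, §1 and §4]
[cite: daSilva2021HodgeFermat, §2, the map `{ } : 𝔅ⁿₘ → Mₘ(n/2 + 1)`] -/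
theorem isHodge_iff_isHodgeMultiset (α : Fin r → ZMod m) :
    IsHodge α ↔ IsHodgeMultiset (univ.val.map α) := by
  have h1 : (∀ a ∈ univ.val.map α, a ≠ 0) ↔ ∀ i, α i ≠ 0 := by
    simp only [Multiset.forall_mem_map_iff, Finset.mem_val, Finset.mem_univ, true_implies]
  have h2 : (univ.val.map α).sum = ∑ i, α i := (Finset.sum_eq_multiset_sum _ _).symm
  have h3 : ∀ t : (ZMod m)ˣ, mNormSum ((univ.val.map α).map fun a ↦ (t : ZMod m) * a) =
      normSum fun i ↦ (t : ZMod m) * α i := by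
    intro t
    rw [normSum_eq_mNormSum, Multiset.map_map]
    rfl
  unfold IsHodge IsAdmissible IsHodgeMultiset
  rw [h1, h2, card_univ_val_map]
  simp_rw [h3]

/-- The multiset of values of a Hodge character is a Hodge multiset. [cite: Shioda1979PJA, §1] -/
theorem IsHodge.isHodgeMultiset {α : Fin r → ZMod m} (h : IsHodge α) :
    IsHodgeMultiset (univ.val.map α) :=
  (isHodge_iff_isHodgeMultiset α).1 h

/-- Every multiset is the multiset of values of a function on `Fin r`, `r` its cardinality
(enumerate a representing list). [folklore] -/
theorem exists_eq_univ_val_map {X : Type*} (s : Multiset X) :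
    ∃ (r : ℕ) (α : Fin r → X), univ.val.map α = s := by
  induction s using Quotient.inductionOn with
  | h l => exact ⟨l.length, l.get, by rw [Fin.univ_val_map, List.ofFn_get]; rfl⟩

/-- A Hodge multiset is the multiset of values of a Hodge character. [cite: Shioda1979PJA, §1] -/
theorem IsHodgeMultiset.exists_isHodge {s : Multiset (ZMod m)} (h : IsHodgeMultiset s) :
    ∃ (r : ℕ) (α : Fin r → ZMod m), IsHodge α ∧ univ.val.map α = s := by
  obtain ⟨r, α, rfl⟩ := exists_eq_univ_val_map s
  exact ⟨r, α, (isHodge_iff_isHodgeMultiset α).2 h, rfl⟩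

/-- Multiplicities of the multiset of values: `#{αᵢ = x} = #{i | αᵢ = x}`. [folklore] -/
theorem count_univ_val_map (α : Fin r → ZMod m) (x : ZMod m) :
    count x (univ.val.map α) = #{i | α i = x} := by
  rw [Multiset.count_map, ← Finset.filter_val, Finset.card_val]
  congr 1
  exact Finset.filter_congr fun i _ ↦ eq_comm

/-! ### Splitting off a pair -/

/-- If `a ∈ s` and either `-a ∈ s` with `-a ≠ a`, or `a = -a` occurs twice, then `s = {a, -a} + t`.
[folklore] -/
theorem exists_eq_pair_add {s : Multiset (ZMod m)} {a : ZMod m} (ha : a ∈ s)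
    (h : if a = -a then 2 ≤ count a s else -a ∈ s) : ∃ t, s = {a, -a} + t := by
  obtain ⟨s', rfl⟩ := Multiset.exists_cons_of_mem ha
  by_cases hn : a = -a
  · rw [if_pos hn, Multiset.count_cons_self] at h
    have ha' : a ∈ s' := Multiset.count_pos.1 (by omega)
    obtain ⟨s'', rfl⟩ := Multiset.exists_cons_of_mem ha'
    refine ⟨s'', ?_⟩
    rw [← hn, Multiset.insert_eq_cons, Multiset.cons_add, Multiset.singleton_add]
  · rw [if_neg hn] at h
    rcases Multiset.mem_cons.1 h with h' | h'
    · exact absurd h'.symm hn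
    obtain ⟨s'', rfl⟩ := Multiset.exists_cons_of_mem h'
    refine ⟨s'', ?_⟩
    rw [Multiset.insert_eq_cons, Multiset.cons_add, Multiset.singleton_add]

/-- **Symmetric multiplicities split off pairs.** If a non-empty Hodge multiset takes every value
as often as its negative, and every self-negative value `a = -a` an even number of times, then
`s = {a, -a} + t` with `t` a Hodge multiset. [cite: Ran1980, Prop. 1.8 (i)] -/
theorem IsHodgeMultiset.exists_eq_pair_add_of_count [NeZero m] {s : Multiset (ZMod m)}
    (h : IsHodgeMultiset s) (hs : s ≠ 0) (hsym : ∀ x, count (-x) s = count x s)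
    (heven : ∀ a ∈ s, a = -a → Even (count a s)) :
    ∃ (a : ZMod m) (t : Multiset (ZMod m)), a ≠ 0 ∧ IsHodgeMultiset t ∧ s = {a, -a} + t := by
  obtain ⟨a, ha⟩ := Multiset.exists_mem_of_ne_zero hs
  have hpos : 0 < count a s := Multiset.count_pos.2 ha
  obtain ⟨t, rfl⟩ : ∃ t, s = {a, -a} + t := by
    refine exists_eq_pair_add ha ?_
    split_ifs with hn
    · obtain ⟨k, hk⟩ := heven a ha hn
      omega
    · exact Multiset.count_pos.1 (by rw [hsym a]; exact hpos)
  exact ⟨a, t, h.1.1 a (by simp), h.of_pair_add, rfl⟩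

/-! ### Prime degree: every value occurs as often as its negative -/

section Prime

variable {p : ℕ} [hp : Fact p.Prime]

/-- For `m = p` prime a Hodge multiset takes every value as often as its negative (Ran Prop. 1.8 (i)
through Koblitz–Ogus, the tree's `IsHodge.card_filter_eq_card_filter_neg`).
[cite: Ran1980, Prop. 1.8 (i)] [cite: KoblitzOgus1979, Proposition (appendix, PSPM 33.2 pp. 343–346)] -/
theorem IsHodgeMultiset.count_neg_eq_count {s : Multiset (ZMod p)} (h : IsHodgeMultiset s)
    (x : ZMod p) : count (-x) s = count x s := by
  obtain ⟨r, α, hα, rfl⟩ := h.exists_isHodge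
  rw [count_univ_val_map, count_univ_val_map, hα.card_filter_eq_card_filter_neg x]

/-- For `p` prime, a non-zero self-negative residue forces `p = 2`, where every non-zero residue is
`1`: so a Hodge multiset containing `a = -a` consists of `a` only. [folklore] -/
theorem count_eq_card_of_eq_neg {s : Multiset (ZMod p)} (h : IsHodgeMultiset s) {a : ZMod p}
    (ha : a ∈ s) (hn : a = -a) : count a s = card s := by
  have ha0 : a ≠ 0 := h.1.1 a ha
  have h2 : p = 2 := by
    by_contra hodd
    have h2a : (2 : ZMod p) * a = 0 := by rw [two_mul]; nth_rw 2 [hn]; exact add_neg_cancel _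
    have h2u : (2 : ZMod p) ≠ 0 := by
      intro h0
      have : (p : ℕ) ∣ 2 := (ZMod.natCast_eq_zero_iff 2 p).mp (by exact_mod_cast h0)
      exact hodd ((Nat.prime_dvd_prime_iff_eq hp.out Nat.prime_two).mp this)
    exact ha0 ((mul_eq_zero.mp h2a).resolve_left h2u)
  subst h2
  rw [Multiset.count_eq_card]
  intro b hb
  rw [(zmod_two_eq_one_of_ne_zero a ha0).1, (zmod_two_eq_one_of_ne_zero b (h.1.1 b hb)).1]

/-- **Prime degree: a non-empty Hodge multiset splits off a pair** `{a, -a}` with Hodge complement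
(`Mₚ` is generated by its elements of length `1`; Ran Prop. 1.8 (i), Shioda PJA Thm. 1 list item 1).
[cite: Ran1980, Prop. 1.8 (i)] [cite: Shioda1979PJA, §2 Thm. 1, list item 1)] -/
theorem IsHodgeMultiset.exists_eq_pair_add_of_prime {s : Multiset (ZMod p)} (h : IsHodgeMultiset s)
    (hs : s ≠ 0) :
    ∃ (a : ZMod p) (t : Multiset (ZMod p)), a ≠ 0 ∧ IsHodgeMultiset t ∧ s = {a, -a} + t := by
  haveI : NeZero p := ⟨hp.out.ne_zero⟩
  refine h.exists_eq_pair_add_of_count hs h.count_neg_eq_count fun a ha hn ↦ ?_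
  rw [count_eq_card_of_eq_neg h ha hn]
  exact h.even_card

end Prime

/-! ### Shioda's decomposability notions and the condition `(Pₘ)` -/

/-- `ξ ∈ Mₘ` is **decomposable**: `ξ = ξ' + ξ''` with `ξ', ξ'' ∈ Mₘ` (non-empty Hodge multisets).
[cite: Shioda1979PJA, §1 Definition (i)] [cite: daSilva2021HodgeFermat, Def. 2.4] -/
def IsDecomposable (s : Multiset (ZMod m)) : Prop :=
  ∃ t u : Multiset (ZMod m), t ≠ 0 ∧ u ≠ 0 ∧ IsHodgeMultiset t ∧ IsHodgeMultiset u ∧ s = t + u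

/-- `ξ ∈ Mₘ` is **quasi-decomposable** (da Silva's Def. 2.4 form): `ξ + η = ξ' + ξ''` for an
element `η = {e, -e}` of length `1` and `ξ', ξ'' ∈ Mₘ` both different from `ξ` (for `ξ`
indecomposable this forces `‖ξ'‖, ‖ξ''‖ < ‖ξ‖`, see the proof of
`IsShiodaClosed.of_shiodaConditionUpTo`). Faithfulness note: Shioda's Definition (ii) (PJA §1, as
far as the held scan is legible) allows the auxiliary `η ∈ Mₘ` to have length `≤ 2`; the length-`1`
form used here (and by da Silva) is the special case whose geometric counterpart is the type-I map
alone, so the condition `ShiodaCondition` built from it IMPLIES Shioda's `(Pⁿₘ)'`.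
[cite: daSilva2021HodgeFermat, Def. 2.4] [cite: Shioda1979PJA, §1 Definition (ii)] -/
def IsQuasiDecomposable (s : Multiset (ZMod m)) : Prop :=
  ∃ e : ZMod m, e ≠ 0 ∧ ∃ t u : Multiset (ZMod m), t ≠ 0 ∧ u ≠ 0 ∧ IsHodgeMultiset t ∧
    IsHodgeMultiset u ∧ t ≠ s ∧ u ≠ s ∧ s + {e, -e} = t + u

/-- `ξ ∈ Mₘ` (of length `3`) is **semi-decomposable**: `x = x' + x''` with `x'`, `x''` two triples
each summing to `0 mod m` (Shioda's congruence (3) with `∑ x'_ν = ∑ x''_ν = 3`: two characters of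
the Fermat CURVE `X¹ₘ`, "this occurs only if `y = 3`"). [cite: Shioda1979PJA, §1 Definition (iii)] -/
def IsSemiDecomposable (s : Multiset (ZMod m)) : Prop :=
  ∃ t u : Multiset (ZMod m), card t = 3 ∧ card u = 3 ∧ t.sum = 0 ∧ u.sum = 0 ∧ s = t + u

/-- **Shioda's condition `(Pₘ)`** (`= (Pⁿₘ)'` of PJA §1, uniform in `n`; da Silva's `(Pₘ)` plus
Shioda's semi-decomposability): every element of `Mₘ` of length `≥ 3` (a Hodge multiset with at
least `6` elements) is decomposable, quasi-decomposable or semi-decomposable. Equivalently (the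
decomposable ones being trivially covered): `Mₘ` has no indecomposable element of length `≥ 3`
which is neither quasi-decomposable nor semi-decomposable. A PREDICATE of `m`, not a named fact:
proved below for `m` prime, `4`, `6`; reported verified for `m ≤ 20` (Shioda, PJA list item 2;
da Silva Thm. 2.7) and `m = 21, 27` (da Silva Thm. 3.5), false for `m = 25, 33` (da Silva §2 and
Prop. 3.6). With quasi-decomposability in the length-`1` form (see `IsQuasiDecomposable`) this
condition implies Shioda's `(Pⁿₘ)'` for every `n`.
[cite: Shioda1979PJA, §1 conditions (Pⁿₘ(H)), (Pⁿₘ(H))' with H = {1}]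
[cite: daSilva2021HodgeFermat, §2 condition (Pₘ), Thm. 2.5–2.7, Prop. 3.6] -/
def ShiodaCondition (m : ℕ) : Prop :=
  ∀ s : Multiset (ZMod m), IsHodgeMultiset s → 6 ≤ card s →
    IsDecomposable s ∨ IsQuasiDecomposable s ∨ IsSemiDecomposable s

/-- **Shioda's condition `(Pⁿₘ)`** for a fixed (even) dimension `n`: the same for the elements of
length `3 ≤ ‖ξ‖ ≤ n/2 + 1`, i.e. Hodge multisets with `6 ≤ #s ≤ n + 2` ("this condition is vacuous
if `n ≤ 2`"). [cite: Shioda1979PJA, §1 condition (Pⁿₘ(H)) with H = {1}]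
[cite: daSilva2021HodgeFermat, §2 condition (Pⁿₘ)] -/
def ShiodaConditionUpTo (m n : ℕ) : Prop :=
  ∀ s : Multiset (ZMod m), IsHodgeMultiset s → 6 ≤ card s → card s ≤ n + 2 →
    IsDecomposable s ∨ IsQuasiDecomposable s ∨ IsSemiDecomposable s

/-- `(Pₘ)` is `(Pⁿₘ)` for all `n`. [cite: Shioda1979PJA, §1] -/
theorem shiodaCondition_iff_forall_upTo : ShiodaCondition m ↔ ∀ n, ShiodaConditionUpTo m n :=
  ⟨fun h _ s hs h6 _ ↦ h s hs h6, fun h s hs h6 ↦ h (card s) s hs h6 (by omega)⟩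

/-- `(Pⁿₘ)` is vacuous for `n ≤ 2`. [cite: Shioda1979PJA, §1 ("This condition is vacuous if n ≤ 2")] -/
theorem shiodaConditionUpTo_of_le_two {n : ℕ} (hn : n ≤ 2) : ShiodaConditionUpTo m n :=
  fun _ _ h6 hle ↦ by omega

/-! ### The inductive spine of Shioda's Theorem 1 -/

/-- A family `C` of multisets of residues mod `m` **closed under the inductive structure of Fermat
varieties.** Intended instance (Shioda PJA §4; da Silva §2): `C = 𝔠ₘ = ⋃ₙ 𝔠ⁿₘ`, the Hodge
characters `α ∈ 𝔅ⁿₘ` (up to permutation of the coordinates, i.e. as multisets) whose eigenspace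
`V(α) ⊂ Hⁿ(Xⁿₘ(ℂ); ℂ)` consists of classes of algebraic cycles, for which the fields say:
* `pair`: `𝔠⁰ₘ = 𝔅⁰ₘ` — on the zero-dimensional Fermat variety (`m` points) every class is algebraic;
* `surface`: `𝔠²ₘ = 𝔅²ₘ` — the Hodge conjecture for the Fermat surface `X²ₘ` (Lefschetz's theorem
  on `(1,1)`-classes);
* `semi`: a Hodge character of `X⁴ₘ` which is a juxtaposition of two characters of the Fermat curve
  `X¹ₘ` is in `𝔠⁴ₘ` — the type-II map `H¹(X¹ₘ) ⊗ H¹(X¹ₘ)(1) → H⁴(X⁴ₘ)` of the inductive structure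
  applied to the Hodge classes of the surface `X¹ₘ × X¹ₘ` (Lefschetz `(1,1)`), Shioda's
  "semi-decomposable" case;
* `star`: `β' ∈ 𝔠^{r-1}ₘ`, `γ' ∈ 𝔠^{s-1}ₘ` (`r, s` odd) `⇒ β' * γ' ∈ 𝔠^{r+s}ₘ` — the type-II summand
  `H^{r-1}_prim(X^{r-1}) ⊗ H^{s-1}_prim(X^{s-1})(1) ↪ H^{r+s}_prim(X^{r+s})` of the inductive
  structure preserves algebraic classes (da Silva Cor. 2.3 (a); `f(Z₁ ⊗ Z₂) = m Z₁ ∧ Z₂`, the ruled join);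
* `hash`: `β ∈ 𝔠ʳₘ`, `γ ∈ 𝔠ˢₘ` (`r, s` even and positive) with `b_{r+1} + c_{s+1} = 0`
  `⇒ β # γ ∈ 𝔠^{r+s}ₘ` — the type-I summand `[Hʳ_prim(Xʳ) ⊗ Hˢ_prim(Xˢ)]^{μₘ} ↪ H^{r+s}_prim(X^{r+s})`
  preserves algebraic classes (da Silva Cor. 2.3 (b)).
Every field carries the Hodge-multiset side conditions under which the geometric statement is made,
so that the structure asks for nothing more than the printed inductive structure gives.
[cite: Shioda1979PJA, §4 (the isomorphism (*) "which preserves algebraic cycles")]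
[cite: daSilva2021HodgeFermat, Thm. 2.2 and Cor. 2.3] -/
structure IsShiodaClosed (C : Multiset (ZMod m) → Prop) : Prop where
  /-- Dimension `0`: the pairs `(a, -a)` are cycle characters. [cite: daSilva2021HodgeFermat, §2 ("true for n ≤ 2")] -/
  pair : ∀ a : ZMod m, a ≠ 0 → C {a, -a}
  /-- Dimension `2`: every Hodge character of the Fermat surface is a cycle character (Lefschetz
  `(1,1)`). [cite: daSilva2021HodgeFermat, §2 ("true for n ≤ 2")] -/
  surface : ∀ s : Multiset (ZMod m), IsHodgeMultiset s → card s = 4 → C s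
  /-- Semi-decomposable Hodge characters of `X⁴ₘ` are cycle characters (`X¹ₘ × X¹ₘ`, Lefschetz
  `(1,1)`, type II). [cite: Shioda1979PJA, §1 Definition (iii) and §4] -/
  semi : ∀ s : Multiset (ZMod m), IsHodgeMultiset s → IsSemiDecomposable s → C s
  /-- Type II: juxtaposition `β' * γ'` of cycle characters is a cycle character.
  [cite: daSilva2021HodgeFermat, Cor. 2.3 (a)] -/
  star : ∀ t u : Multiset (ZMod m), t ≠ 0 → u ≠ 0 → IsHodgeMultiset t → IsHodgeMultiset u →
    C t → C u → C (t + u)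
  /-- Type I: `β # γ` (drop a cancelling pair of coordinates from the juxtaposition of two cycle
  characters of positive even dimension) is a cycle character. [cite: daSilva2021HodgeFermat, Cor. 2.3 (b)] -/
  hash : ∀ (e : ZMod m) (t u : Multiset (ZMod m)), IsHodgeMultiset (e ::ₘ t) →
    IsHodgeMultiset ((-e) ::ₘ u) → IsHodgeMultiset (t + u) → 4 ≤ card (e ::ₘ t) →
      4 ≤ card ((-e) ::ₘ u) → C (e ::ₘ t) → C ((-e) ::ₘ u) → C (t + u)

/-- `{e, -e} + s = e ::ₘ -e ::ₘ s`. [folklore] -/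
theorem pair_add_eq_cons_cons (e : ZMod m) (s : Multiset (ZMod m)) :
    ({e, -e} : Multiset (ZMod m)) + s = e ::ₘ ((-e) ::ₘ s) := by
  rw [Multiset.insert_eq_cons, Multiset.cons_add, Multiset.singleton_add]

/-- **The inductive spine of Shioda's Theorem 1** (PJA §2 Thm. 1 with §4; da Silva Thm. 2.5): if
`(Pⁿₘ)` holds and `C` is closed under the inductive structure of Fermat varieties
(`IsShiodaClosed C`), then every non-empty Hodge multiset with at most `n + 2` elements — every
Hodge character of `X^dₘ`, `d ≤ n`, up to permutation — lies in `C`. With `C = 𝔠ₘ` this is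
"`(Pⁿₘ) ⇒` the Hodge conjecture for `Xⁿₘ`" granted the geometric inputs listed at `IsShiodaClosed`
and the character decomposition `Hdgᵖ(X²ᵖₘ) ⊗ ℂ = ⨁_{α ∈ 𝔅} V(α)`. Proof: strong induction on the
cardinality; `#s = 2`: a pair; `#s = 4`: `surface`; `#s ≥ 6`: by `(Pⁿₘ)` the multiset is
decomposable (`star` and induction), semi-decomposable (`semi`), or quasi-decomposable,
`s + {e, -e} = t + u`: if `e ∈ t` and `-e ∈ u` then `s = t' # u'`-shape and `hash` applies to
`t = e ::ₘ t'`, `u = -e ::ₘ u'` (both of cardinality `≥ 4` and `< #s` because `t, u ≠ s`), while if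
`e, -e` fall in the same part `t = {e, -e} + t''` then `s = t'' + u` is decomposable after all.
[cite: Shioda1979PJA, §2 Thm. 1 and §4] [cite: daSilva2021HodgeFermat, Cor. 2.3 and Thm. 2.5] -/
theorem IsShiodaClosed.of_shiodaConditionUpTo [NeZero m] {C : Multiset (ZMod m) → Prop}
    (hC : IsShiodaClosed C) {n : ℕ} (hP : ShiodaConditionUpTo m n) :
    ∀ s : Multiset (ZMod m), s ≠ 0 → IsHodgeMultiset s → card s ≤ n + 2 → C s := by
  -- strong induction on the cardinality
  suffices H : ∀ k, ∀ s : Multiset (ZMod m), card s = k → s ≠ 0 → IsHodgeMultiset s →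
      card s ≤ n + 2 → C s from fun s ↦ H _ s rfl
  intro k
  induction k using Nat.strong_induction_on with
  | _ k ih =>
  intro s hk hs0 hs hsn
  -- the quasi-decomposable case with `e ∈ t`, as a lemma applied twice (symmetry `t ↔ u`)
  have quasi : ∀ (e : ZMod m) (t u : Multiset (ZMod m)), t ≠ 0 → u ≠ 0 → IsHodgeMultiset t →
      IsHodgeMultiset u → t ≠ s → u ≠ s → s + {e, -e} = t + u → e ∈ t → C s := by
    intro e t u ht0 hu0 ht hu hts hus hstu het
    have he : e ≠ 0 := ht.1.1 e het
    obtain ⟨t', rfl⟩ := Multiset.exists_cons_of_mem het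
    -- cancel `e`: `-e ::ₘ s = t' + u`
    have h1 : (-e) ::ₘ s = t' + u := by
      rw [add_comm, pair_add_eq_cons_cons, Multiset.cons_add] at hstu
      exact (Multiset.cons_inj_right e).1 hstu
    have hne : -e ∈ t' + u := by rw [← h1]; exact Multiset.mem_cons_self _ _
    rcases Multiset.mem_add.1 hne with h2 | h2
    · -- `e, -e ∈ t`: `t = {e,-e} + t''`, `s = t'' + u` is decomposable
      obtain ⟨t'', rfl⟩ := Multiset.exists_cons_of_mem h2
      have h3 : s = t'' + u := by
        rw [Multiset.cons_add] at h1
        exact (Multiset.cons_inj_right _).1 h1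
      have ht'' : IsHodgeMultiset t'' := by
        rw [← pair_add_eq_cons_cons] at ht
        exact ht.of_pair_add
      have ht''0 : t'' ≠ 0 := by
        rintro rfl
        rw [zero_add] at h3
        exact hus h3.symm
      have hct : card t'' < card s := by
        rw [h3, Multiset.card_add]
        have := hu.two_le_card hu0
        omega
      have hcu : card u < card s := by
        rw [h3, Multiset.card_add]
        have := ht''.two_le_card ht''0
        omega
      rw [h3]
      exact hC.star t'' u ht''0 hu0 ht'' hu (ih _ (hk ▸ hct) t'' rfl ht''0 ht'' (by omega))
        (ih _ (hk ▸ hcu) u rfl hu0 hu (by omega))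
    · -- `e ∈ t`, `-e ∈ u`: `s = t' + u'` and `hash` applies
      obtain ⟨u', rfl⟩ := Multiset.exists_cons_of_mem h2
      have h3 : s = t' + u' := by
        rw [Multiset.add_cons] at h1
        exact (Multiset.cons_inj_right _).1 h1
      -- `u ≠ {e, -e}` because `t ≠ s`; hence `#u ≥ 4`, and symmetrically
      have hcu4 : 4 ≤ card ((-e) ::ₘ u') := by
        obtain ⟨j, hj⟩ := hu.even_card
        by_contra hlt
        have hu2 : card ((-e) ::ₘ u') = 2 := by
          have := hu.two_le_card hu0
          omega
        apply hts
        -- `u = {-e, e}`, so `s + {e,-e} = t + {e,-e}` and `t = s`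
        have hsum : ((-e) ::ₘ u').sum = 0 := hu.1.2
        rw [Multiset.card_cons] at hu2
        obtain ⟨b, hb⟩ := Multiset.card_eq_one.1 (by omega : card u' = 1)
        rw [hb, Multiset.sum_cons, Multiset.sum_singleton, neg_add_eq_zero] at hsum
        subst hsum
        rw [hb] at hstu
        change s + {e, -e} = e ::ₘ t' + {-e, e} at hstu
        rw [Multiset.pair_comm (-e) e] at hstu
        exact (add_right_cancel hstu).symm
      have hct4 : 4 ≤ card (e ::ₘ t') := by
        obtain ⟨j, hj⟩ := ht.even_card
        by_contra hlt
        have ht2 : card (e ::ₘ t') = 2 := by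
          have := ht.two_le_card ht0
          omega
        apply hus
        -- `t = {e, -e}`, so `s + {e,-e} = {e,-e} + u` and `u = s`
        have hsum : (e ::ₘ t').sum = 0 := ht.1.2
        rw [Multiset.card_cons] at ht2
        obtain ⟨b, hb⟩ := Multiset.card_eq_one.1 (by omega : card t' = 1)
        rw [hb, Multiset.sum_cons, Multiset.sum_singleton, add_eq_zero_iff_eq_neg'] at hsum
        subst hsum
        rw [hb] at hstu
        change s + {e, -e} = {e, -e} + ((-e) ::ₘ u') at hstu
        rw [add_comm ({e, -e} : Multiset (ZMod m))] at hstu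
        exact (add_right_cancel hstu).symm
      have hcards : card (e ::ₘ t') + card ((-e) ::ₘ u') = card s + 2 := by
        rw [h3, Multiset.card_cons, Multiset.card_cons, Multiset.card_add]; ring
      have hct : card (e ::ₘ t') < card s := by omega
      have hcu : card ((-e) ::ₘ u') < card s := by omega
      have hs' : IsHodgeMultiset (t' + u') := h3 ▸ hs
      rw [h3]
      exact hC.hash e t' u' ht hu hs' hct4 hcu4
        (ih _ (hk ▸ hct) _ rfl (Multiset.cons_ne_zero) ht (by omega))
        (ih _ (hk ▸ hcu) _ rfl (Multiset.cons_ne_zero) hu (by omega))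
  -- case distinction on the cardinality
  obtain ⟨j, hj⟩ := hs.even_card
  have h2 := hs.two_le_card hs0
  rcases Nat.lt_or_ge (card s) 6 with hlt | h6
  · rcases Nat.lt_or_ge (card s) 4 with hlt4 | h4
    · -- `#s = 2`: a pair
      obtain ⟨a, ha, rfl⟩ := hs.eq_pair_of_card_eq_two (by omega)
      exact hC.pair a ha
    · exact hC.surface s hs (by omega)
  rcases hP s hs h6 hsn with ⟨t, u, ht0, hu0, ht, hu, rfl⟩ | ⟨e, -, t, u, ht0, hu0, ht, hu, hts, hus, hstu⟩ | hsemi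
  · -- decomposable
    have hct : card t < card (t + u) := by
      rw [Multiset.card_add]; have := hu.two_le_card hu0; omega
    have hcu : card u < card (t + u) := by
      rw [Multiset.card_add]; have := ht.two_le_card ht0; omega
    exact hC.star t u ht0 hu0 ht hu (ih _ (hk ▸ hct) t rfl ht0 ht (by omega))
      (ih _ (hk ▸ hcu) u rfl hu0 hu (by omega))
  · -- quasi-decomposable: `e ∈ t` or `e ∈ u`
    have he : e ∈ t + u := by rw [← hstu]; simp
    rcases Multiset.mem_add.1 he with het | heu
    · exact quasi e t u ht0 hu0 ht hu hts hus hstu het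
    · exact quasi e u t hu0 ht0 hu ht hus hts (hstu.trans (add_comm t u)) heu
  · exact hC.semi s hs hsemi

/-- **Shioda's Theorem 1, spine, uniform in the dimension** (da Silva Thm. 2.5, first sentence):
under `(Pₘ)` every non-empty Hodge multiset lies in every family closed under the inductive
structure. [cite: Shioda1979PJA, §2 Thm. 1] [cite: daSilva2021HodgeFermat, Thm. 2.5] -/
theorem IsShiodaClosed.of_shiodaCondition [NeZero m] {C : Multiset (ZMod m) → Prop}
    (hC : IsShiodaClosed C) (hP : ShiodaCondition m) :
    ∀ s : Multiset (ZMod m), s ≠ 0 → IsHodgeMultiset s → C s :=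
  fun s hs0 hs ↦ hC.of_shiodaConditionUpTo (shiodaCondition_iff_forall_upTo.1 hP (card s)) s hs0 hs
    (Nat.le_add_right _ _)


/-! ### Semigroups generated by pairs: `m` prime and `m = 4` -/

/-- **If every non-empty Hodge multiset splits off a pair, then `(Pₘ)` holds trivially**: every
Hodge multiset with at least `4` elements is decomposable (`Mₘ` is generated by `Mₘ(1)`).
[cite: daSilva2021HodgeFermat, §2 (before Thm. 2.6: "Mₘ is generated by Mₘ(1)")] -/
theorem isDecomposable_of_pairSplitting [NeZero m]
    (hsplit : ∀ s : Multiset (ZMod m), IsHodgeMultiset s → s ≠ 0 →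
      ∃ (a : ZMod m) (t : Multiset (ZMod m)), a ≠ 0 ∧ IsHodgeMultiset t ∧ s = {a, -a} + t)
    {s : Multiset (ZMod m)} (hs : IsHodgeMultiset s) (h4 : 4 ≤ card s) : IsDecomposable s := by
  obtain ⟨a, t, ha, ht, rfl⟩ := hsplit s hs (by rintro rfl; simp at h4)
  refine ⟨{a, -a}, t, by simp, ?_, IsHodgeMultiset.pair ha, ht, rfl⟩
  rintro rfl
  simp at h4

/-- Under the same pair-splitting hypothesis `(Pₘ)` holds. [cite: daSilva2021HodgeFermat, Thm. 2.6] -/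
theorem shiodaCondition_of_pairSplitting [NeZero m]
    (hsplit : ∀ s : Multiset (ZMod m), IsHodgeMultiset s → s ≠ 0 →
      ∃ (a : ZMod m) (t : Multiset (ZMod m)), a ≠ 0 ∧ IsHodgeMultiset t ∧ s = {a, -a} + t) :
    ShiodaCondition m :=
  fun _ hs h6 ↦ Or.inl (isDecomposable_of_pairSplitting hsplit hs (by omega))

/-- **Generation by pairs**: under the pair-splitting hypothesis every non-empty Hodge multiset lies
in every family containing the pairs and closed under juxtaposition (no surface, semi- or type-I
input needed) — the shape of Ran's Thm. 4.9 ("the Hodge subspace is generated by the homology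
classes of linear spaces"). [cite: Ran1980, Thm. 4.9] [cite: daSilva2021HodgeFermat, Thm. 2.6] -/
theorem forall_of_pairSplitting [NeZero m]
    (hsplit : ∀ s : Multiset (ZMod m), IsHodgeMultiset s → s ≠ 0 →
      ∃ (a : ZMod m) (t : Multiset (ZMod m)), a ≠ 0 ∧ IsHodgeMultiset t ∧ s = {a, -a} + t)
    {C : Multiset (ZMod m) → Prop} (hpair : ∀ a : ZMod m, a ≠ 0 → C {a, -a})
    (hstar : ∀ t u : Multiset (ZMod m), t ≠ 0 → u ≠ 0 → IsHodgeMultiset t → IsHodgeMultiset u →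
      C t → C u → C (t + u)) :
    ∀ s : Multiset (ZMod m), s ≠ 0 → IsHodgeMultiset s → C s := by
  suffices H : ∀ k, ∀ s : Multiset (ZMod m), card s = k → s ≠ 0 → IsHodgeMultiset s → C s from
    fun s ↦ H _ s rfl
  intro k
  induction k using Nat.strong_induction_on with
  | _ k ih =>
  intro s hk hs0 hs
  obtain ⟨a, t, ha, ht, rfl⟩ := hsplit s hs hs0
  by_cases ht0 : t = 0
  · subst ht0
    rw [add_zero]
    exact hpair a ha
  · have hct : card t < card ({a, -a} + t) := by rw [Multiset.card_add]; simp
    exact hstar _ t (by simp) ht0 (IsHodgeMultiset.pair ha) ht (hpair a ha)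
      (ih _ (hk ▸ hct) t rfl ht0 ht)

section Prime

variable {p : ℕ} [hp : Fact p.Prime]

/-- **`(Pₚ)` for `p` prime** (Shioda PJA Thm. 1, list item 1 (Parry); da Silva Thm. 2.6): every
Hodge multiset with `≥ 4` elements is decomposable, so the condition holds with its first
alternative. [cite: Shioda1979PJA, §2 Thm. 1, list item 1)] [cite: daSilva2021HodgeFermat, Thm. 2.6]
[cite: Ran1980, Prop. 1.8 (i)] -/
theorem shiodaCondition_of_prime : ShiodaCondition p :=
  haveI : NeZero p := ⟨hp.out.ne_zero⟩
  shiodaCondition_of_pairSplitting fun _ hs hs0 ↦ hs.exists_eq_pair_add_of_prime hs0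

/-- **Prime degree: Hodge multisets are generated by pairs** — every non-empty Hodge multiset lies in
every family containing the pairs `{a, -a}` and closed under juxtaposition (with `C = 𝔠ₚ`: the Hodge
classes of `Xⁿₚ` are spanned by classes of linear subspaces, Ran Thm. 4.9, granted the character
decomposition and the classes of linear spaces). [cite: Ran1980, Thm. 4.9] [cite: Shioda1979PJA, §2 Thm. 1, list item 1)] -/
theorem forall_of_prime {C : Multiset (ZMod p) → Prop} (hpair : ∀ a : ZMod p, a ≠ 0 → C {a, -a})
    (hstar : ∀ t u : Multiset (ZMod p), t ≠ 0 → u ≠ 0 → IsHodgeMultiset t → IsHodgeMultiset u →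
      C t → C u → C (t + u)) :
    ∀ s : Multiset (ZMod p), s ≠ 0 → IsHodgeMultiset s → C s :=
  haveI : NeZero p := ⟨hp.out.ne_zero⟩
  forall_of_pairSplitting (fun _ hs hs0 ↦ hs.exists_eq_pair_add_of_prime hs0) hpair hstar

end Prime

/-! ### Degree `4` -/

section Four

/-- Sum of a function over a multiset through the multiplicities. [folklore] -/
theorem sum_map_eq_sum_count_mul {ι : Type*} [DecidableEq ι] [Fintype ι] (s : Multiset ι)
    (f : ι → ℕ) : (s.map f).sum = ∑ x, count x s * f x := by
  rw [Finset.sum_multiset_map_count]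
  simp_rw [smul_eq_mul]
  exact Fintype.sum_subset fun i hi ↦ Multiset.mem_toFinset.2
    (Multiset.count_pos.1 (Nat.pos_of_ne_zero fun h0 ↦ hi (by rw [h0, zero_mul])))

/-- Sum of a multiset through the multiplicities. [folklore] -/
theorem sum_eq_sum_count_nsmul {ι : Type*} [DecidableEq ι] [Fintype ι] [AddCommMonoid ι]
    (s : Multiset ι) : s.sum = ∑ x, count x s • x := by
  rw [Finset.sum_multiset_count]
  exact Fintype.sum_subset fun i hi ↦ Multiset.mem_toFinset.2
    (Multiset.count_pos.1 (Nat.pos_of_ne_zero fun h0 ↦ hi (by rw [h0, zero_smul])))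

/-- Cardinality through the multiplicities. [folklore] -/
theorem card_eq_sum_count {ι : Type*} [DecidableEq ι] [Fintype ι] (s : Multiset ι) :
    card s = ∑ x, count x s :=
  (Multiset.sum_count_eq_card fun a _ ↦ Finset.mem_univ a).symm

/-- **The semigroup `M₄`**: a Hodge multiset over `ℤ/4` takes the value `3 = -1` as often as `1`,
and the value `2 = -2` an even number of times (`x₁ + 2x₂ + 3x₃ = 2(x₁ + x₂ + x₃)` and
`x₁ + 2x₂ + 3x₃ ≡ 0 mod 4`). [cite: daSilva2021HodgeFermat, §2 (before Thm. 2.6: "for m = 4, Mₘ is generated by Mₘ(1)")] -/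
theorem IsHodgeMultiset.count_of_four {s : Multiset (ZMod 4)} (h : IsHodgeMultiset s) :
    count 3 s = count 1 s ∧ Even (count 2 s) := by
  have h0 : count 0 s = 0 := Multiset.count_eq_zero.2 fun h0 ↦ h.1.1 0 h0 rfl
  have huniv : (univ : Finset (ZMod 4)) = {0, 1, 2, 3} := by decide
  have h0n : (0 : ZMod 4) ∉ ({1, 2, 3} : Finset (ZMod 4)) := by decide
  have h1n : (1 : ZMod 4) ∉ ({2, 3} : Finset (ZMod 4)) := by decide
  have h2n : (2 : ZMod 4) ∉ ({3} : Finset (ZMod 4)) := by decide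
  have h1v : (1 : ZMod 4).val = 1 := rfl
  have h2v : (2 : ZMod 4).val = 2 := rfl
  have h3v : (3 : ZMod 4).val = 3 := rfl
  have hn := h.2 1
  simp only [Units.val_one, one_mul, Multiset.map_id'] at hn
  rw [mNormSum, sum_map_eq_sum_count_mul, card_eq_sum_count, huniv] at hn
  have hsum := h.1.2
  rw [sum_eq_sum_count_nsmul, huniv] at hsum
  simp only [Finset.sum_insert h0n, Finset.sum_insert h1n, Finset.sum_insert h2n,
    Finset.sum_singleton, h0, zero_mul, zero_add, zero_smul, h1v, h2v, h3v] at hn hsum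
  have h31 : count 3 s = count 1 s := by omega
  refine ⟨h31, ?_⟩
  rw [h31] at hsum
  simp only [nsmul_eq_mul] at hsum
  -- `c₁ + 2 c₂ + 3 c₁ = 4 c₁ + 2 c₂ ≡ 0 (mod 4)` forces `c₂` even
  have hcast : (((4 * count 1 s + 2 * count 2 s : ℕ)) : ZMod 4) = 0 := by
    push_cast
    linear_combination hsum
  rw [ZMod.natCast_eq_zero_iff] at hcast
  exact even_iff_two_dvd.2 (by omega)

/-- **`M₄` is generated by pairs**: a non-empty Hodge multiset over `ℤ/4` splits off `{1, 3}` or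
`{2, 2}` with Hodge complement. [cite: daSilva2021HodgeFermat, Thm. 2.6] -/
theorem IsHodgeMultiset.exists_eq_pair_add_of_four {s : Multiset (ZMod 4)} (h : IsHodgeMultiset s)
    (hs : s ≠ 0) :
    ∃ (a : ZMod 4) (t : Multiset (ZMod 4)), a ≠ 0 ∧ IsHodgeMultiset t ∧ s = {a, -a} + t := by
  obtain ⟨h31, h2⟩ := h.count_of_four
  have hcases : ∀ x : ZMod 4, x = 0 ∨ x = 1 ∨ x = 2 ∨ x = 3 := by decide
  have hneg1 : (-1 : ZMod 4) = 3 := by decide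
  have hneg2 : (-2 : ZMod 4) = 2 := by decide
  have hneg3 : (-3 : ZMod 4) = 1 := by decide
  have hself : ∀ a : ZMod 4, a ≠ 0 → a = -a → a = 2 := by decide
  refine h.exists_eq_pair_add_of_count hs (fun x ↦ ?_) (fun a ha hn ↦ ?_)
  · rcases hcases x with rfl | rfl | rfl | rfl
    · rw [neg_zero]
    · rw [hneg1, h31]
    · rw [hneg2]
    · rw [hneg3, h31]
  · rw [hself a (h.1.1 a ha) hn]
    exact h2

/-- **`(P₄)`** (da Silva Thm. 2.6; within Shioda's `m ≤ 20`, list item 2): every Hodge multiset over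
`ℤ/4` with `≥ 4` elements is decomposable. [cite: daSilva2021HodgeFermat, Thm. 2.6]
[cite: Shioda1979PJA, §2 Thm. 1, list item 2)] -/
theorem shiodaCondition_four : ShiodaCondition 4 :=
  shiodaCondition_of_pairSplitting fun _ hs hs0 ↦ hs.exists_eq_pair_add_of_four hs0

/-- **Degree `4`: Hodge multisets are generated by pairs.** [cite: daSilva2021HodgeFermat, Thm. 2.6] -/
theorem forall_of_four {C : Multiset (ZMod 4) → Prop} (hpair : ∀ a : ZMod 4, a ≠ 0 → C {a, -a})
    (hstar : ∀ t u : Multiset (ZMod 4), t ≠ 0 → u ≠ 0 → IsHodgeMultiset t → IsHodgeMultiset u →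
      C t → C u → C (t + u)) :
    ∀ s : Multiset (ZMod 4), s ≠ 0 → IsHodgeMultiset s → C s :=
  forall_of_pairSplitting (fun _ hs hs0 ↦ hs.exists_eq_pair_add_of_four hs0) hpair hstar

end Four


/-! ### Degree `6`: the first case not generated by pairs -/

section Six

/-- Splitting off a pair from a Hodge multiset with `≥ 4` elements decomposes it. [folklore] -/
theorem IsHodgeMultiset.isDecomposable_of_pair [NeZero m] {s : Multiset (ZMod m)}
    (hs : IsHodgeMultiset s) (h4 : 4 ≤ card s) {a : ZMod m} (ha : a ∈ s)
    (h : if a = -a then 2 ≤ count a s else -a ∈ s) : IsDecomposable s := by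
  obtain ⟨u, rfl⟩ := exists_eq_pair_add ha h
  have ha0 : a ≠ 0 := hs.1.1 a ha
  refine ⟨{a, -a}, u, by simp, ?_, IsHodgeMultiset.pair ha0, hs.of_pair_add, rfl⟩
  rintro rfl
  simp at h4

/-- A proper non-empty Hodge sub-multiset decomposes a Hodge multiset (the complement is Hodge by
cancellation). [cite: Shioda1979PJA, §1 Definition (i)] -/
theorem IsHodgeMultiset.isDecomposable_of_le [NeZero m] {s t : Multiset (ZMod m)}
    (hs : IsHodgeMultiset s) (ht : IsHodgeMultiset t) (ht0 : t ≠ 0) (hle : t ≤ s)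
    (hlt : card t < card s) : IsDecomposable s := by
  obtain ⟨u, rfl⟩ := Multiset.le_iff_exists_add.1 hle
  refine ⟨t, u, ht0, ?_, ht, hs.of_add_left ht, rfl⟩
  rintro rfl
  simp at hlt

/-- **The semigroup `M₆`**: for a Hodge multiset over `ℤ/6` with multiplicities `xᵢ`,
`x₀ = 0` and `2x₁ + x₂ = x₄ + 2x₅` (`∑ ν x_ν = 3 ∑ x_ν`). [cite: Shioda1979PJA, §1 eq. (2)] -/
theorem IsHodgeMultiset.count_of_six {s : Multiset (ZMod 6)} (h : IsHodgeMultiset s) :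
    count 0 s = 0 ∧ 2 * count 1 s + count 2 s = count 4 s + 2 * count 5 s ∧
      card s = count 1 s + count 2 s + count 3 s + count 4 s + count 5 s := by
  have h0 : count 0 s = 0 := Multiset.count_eq_zero.2 fun h0 ↦ h.1.1 0 h0 rfl
  have huniv : (univ : Finset (ZMod 6)) = {0, 1, 2, 3, 4, 5} := by decide
  have h0n : (0 : ZMod 6) ∉ ({1, 2, 3, 4, 5} : Finset (ZMod 6)) := by decide
  have h1n : (1 : ZMod 6) ∉ ({2, 3, 4, 5} : Finset (ZMod 6)) := by decide
  have h2n : (2 : ZMod 6) ∉ ({3, 4, 5} : Finset (ZMod 6)) := by decide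
  have h3n : (3 : ZMod 6) ∉ ({4, 5} : Finset (ZMod 6)) := by decide
  have h4n : (4 : ZMod 6) ∉ ({5} : Finset (ZMod 6)) := by decide
  have h1v : (1 : ZMod 6).val = 1 := rfl
  have h2v : (2 : ZMod 6).val = 2 := rfl
  have h3v : (3 : ZMod 6).val = 3 := rfl
  have h4v : (4 : ZMod 6).val = 4 := rfl
  have h5v : (5 : ZMod 6).val = 5 := rfl
  have hn := h.2 1
  simp only [Units.val_one, one_mul, Multiset.map_id'] at hn
  rw [mNormSum, sum_map_eq_sum_count_mul, card_eq_sum_count, huniv] at hn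
  have hc := card_eq_sum_count s
  rw [huniv] at hc
  simp only [Finset.sum_insert h0n, Finset.sum_insert h1n, Finset.sum_insert h2n,
    Finset.sum_insert h3n, Finset.sum_insert h4n, Finset.sum_singleton, h0, zero_mul, zero_add,
    h1v, h2v, h3v, h4v, h5v] at hn hc
  exact ⟨h0, by omega, by omega⟩

/-- The two indecomposable elements of length `3` of `M₆` are `{1,1,4,4,4,4}` and its negative
`{5,5,2,2,2,2}`; here: the first is a Hodge multiset. [cite: Shioda1979PJA, §2 Thm. 1, list item 2)] -/
theorem isHodgeMultiset_six₁ : IsHodgeMultiset ({1, 1, 4, 4, 4, 4} : Multiset (ZMod 6)) := by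
  unfold IsHodgeMultiset mNormSum; decide

/-- `{5,5,2,2,2,2}` is a Hodge multiset over `ℤ/6`. [cite: Shioda1979PJA, §2 Thm. 1, list item 2)] -/
theorem isHodgeMultiset_six₅ : IsHodgeMultiset ({5, 5, 2, 2, 2, 2} : Multiset (ZMod 6)) := by
  unfold IsHodgeMultiset mNormSum; decide

/-- `{1,4,4,3}` (a Hodge character of the Fermat sextic surface not coming from lines) is a Hodge
multiset over `ℤ/6`. [cite: Shioda1979PJA, §1] -/
theorem isHodgeMultiset_six₁₄₄₃ : IsHodgeMultiset ({1, 4, 4, 3} : Multiset (ZMod 6)) := by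
  unfold IsHodgeMultiset mNormSum; decide

/-- `{5,2,2,3}` is a Hodge multiset over `ℤ/6`. [cite: Shioda1979PJA, §1] -/
theorem isHodgeMultiset_six₅₂₂₃ : IsHodgeMultiset ({5, 2, 2, 3} : Multiset (ZMod 6)) := by
  unfold IsHodgeMultiset mNormSum; decide

/-- **`{1,1,4,4,4,4}` is quasi-decomposable**: `{1,1,4,4,4,4} + {3,3} = {1,4,4,3} + {1,4,4,3}`
(non-vacuity of Shioda's second alternative). [cite: Shioda1979PJA, §1 Definition (ii)] -/
theorem isQuasiDecomposable_six₁ : IsQuasiDecomposable ({1, 1, 4, 4, 4, 4} : Multiset (ZMod 6)) :=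
  ⟨3, by decide, {1, 4, 4, 3}, {1, 4, 4, 3}, by decide, by decide, isHodgeMultiset_six₁₄₄₃,
    isHodgeMultiset_six₁₄₄₃, by decide, by decide, by decide⟩

/-- `{5,5,2,2,2,2}` is quasi-decomposable: `{5,5,2,2,2,2} + {3,3} = {5,2,2,3} + {5,2,2,3}`.
[cite: Shioda1979PJA, §1 Definition (ii)] -/
theorem isQuasiDecomposable_six₅ : IsQuasiDecomposable ({5, 5, 2, 2, 2, 2} : Multiset (ZMod 6)) :=
  ⟨3, by decide, {5, 2, 2, 3}, {5, 2, 2, 3}, by decide, by decide, isHodgeMultiset_six₅₂₂₃,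
    isHodgeMultiset_six₅₂₂₃, by decide, by decide, by decide⟩

/-- `{1,1,4,4,4,4}` is also semi-decomposable: `{1,1,4} + {4,4,4}`, two characters of the Fermat
sextic curve (non-vacuity of Shioda's third alternative). [cite: Shioda1979PJA, §1 Definition (iii)] -/
theorem isSemiDecomposable_six₁ : IsSemiDecomposable ({1, 1, 4, 4, 4, 4} : Multiset (ZMod 6)) :=
  ⟨{1, 1, 4}, {4, 4, 4}, rfl, rfl, by decide, by decide, by decide⟩

/-- **`(P₆)`** (within Shioda's verification for `m ≤ 20`, PJA Thm. 1 list item 2): a Hodge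
multiset over `ℤ/6` with `≥ 6` elements is decomposable unless it is `{1,1,4,4,4,4}` or
`{5,5,2,2,2,2}`, which are quasi-decomposable. Proof: split off `{3,3}`, `{1,5}` or `{2,4}` when
possible; otherwise `2x₁ + x₂ = x₄ + 2x₅` leaves only `x₁ ≥ 2, x₄ = 2x₁` (or its negative), which
contains `{1,1,4,4,4,4}`, properly unless equal to it. [cite: Shioda1979PJA, §2 Thm. 1, list item 2)] -/
theorem shiodaCondition_six : ShiodaCondition 6 := by
  intro s hs h6
  obtain ⟨h0, hrel, hcard⟩ := hs.count_of_six
  obtain ⟨j, hj⟩ := hs.even_card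
  have hn1 : (-1 : ZMod 6) = 5 := by decide
  have hn2 : (-2 : ZMod 6) = 4 := by decide
  -- (a) two `3`s: split off `{3, 3}`
  by_cases h3 : 2 ≤ count 3 s
  · refine Or.inl (hs.isDecomposable_of_pair (by omega) (a := 3)
      (Multiset.count_pos.1 (by omega)) ?_)
    rw [if_pos (by decide)]
    exact h3
  -- (b) `1` and `5`: split off `{1, 5}`
  by_cases h15 : 1 ≤ count 1 s ∧ 1 ≤ count 5 s
  · refine Or.inl (hs.isDecomposable_of_pair (by omega) (a := 1)
      (Multiset.count_pos.1 (by omega)) ?_)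
    rw [if_neg (by decide), hn1]
    exact Multiset.count_pos.1 (by omega)
  -- (c) `2` and `4`: split off `{2, 4}`
  by_cases h24 : 1 ≤ count 2 s ∧ 1 ≤ count 4 s
  · refine Or.inl (hs.isDecomposable_of_pair (by omega) (a := 2)
      (Multiset.count_pos.1 (by omega)) ?_)
    rw [if_neg (by decide), hn2]
    exact Multiset.count_pos.1 (by omega)
  -- (d) the remaining multisets are supported on `{1, 4}` (or `{5, 2}`) plus at most one `3`
  have hcases : ∀ x : ZMod 6, x = 0 ∨ x = 1 ∨ x = 2 ∨ x = 3 ∨ x = 4 ∨ x = 5 := by decide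
  by_cases hc1 : 1 ≤ count 1 s
  · have hc5 : count 5 s = 0 := by omega
    have hc2 : count 2 s = 0 := by omega
    have hc4 : count 4 s = 2 * count 1 s := by omega
    by_cases hc1' : count 1 s = 2
    · -- `s = {1,1,4,4,4,4}`
      have hc3 : count 3 s = 0 := by omega
      have hsw : s = {1, 1, 4, 4, 4, 4} := by
        refine Multiset.ext' fun a ↦ ?_
        rcases hcases a with rfl | rfl | rfl | rfl | rfl | rfl
        · rw [h0]; decide
        · rw [hc1']; decide
        · rw [hc2]; decide
        · rw [hc3]; decide
        · rw [hc4, hc1']; decide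
        · rw [hc5]; decide
      rw [hsw]
      exact Or.inr (Or.inl isQuasiDecomposable_six₁)
    · -- `s` properly contains `{1,1,4,4,4,4}`
      refine Or.inl (hs.isDecomposable_of_le isHodgeMultiset_six₁ (by decide) ?_ ?_)
      · refine Multiset.le_iff_count.2 fun a ↦ ?_
        rcases hcases a with rfl | rfl | rfl | rfl | rfl | rfl
        · rw [show count (0 : ZMod 6) ({1, 1, 4, 4, 4, 4} : Multiset (ZMod 6)) = 0 from by decide]; omega
        · rw [show count (1 : ZMod 6) ({1, 1, 4, 4, 4, 4} : Multiset (ZMod 6)) = 2 from by decide]; omega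
        · rw [show count (2 : ZMod 6) ({1, 1, 4, 4, 4, 4} : Multiset (ZMod 6)) = 0 from by decide]; omega
        · rw [show count (3 : ZMod 6) ({1, 1, 4, 4, 4, 4} : Multiset (ZMod 6)) = 0 from by decide]; omega
        · rw [show count (4 : ZMod 6) ({1, 1, 4, 4, 4, 4} : Multiset (ZMod 6)) = 4 from by decide]; omega
        · rw [show count (5 : ZMod 6) ({1, 1, 4, 4, 4, 4} : Multiset (ZMod 6)) = 0 from by decide]; omega
      · show 6 < card s
        omega
  by_cases hc5 : 1 ≤ count 5 s
  · have hc1 : count 1 s = 0 := by omega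
    have hc4 : count 4 s = 0 := by omega
    have hc2 : count 2 s = 2 * count 5 s := by omega
    by_cases hc5' : count 5 s = 2
    · -- `s = {5,5,2,2,2,2}`
      have hc3 : count 3 s = 0 := by omega
      have hsw : s = {5, 5, 2, 2, 2, 2} := by
        refine Multiset.ext' fun a ↦ ?_
        rcases hcases a with rfl | rfl | rfl | rfl | rfl | rfl
        · rw [h0]; decide
        · rw [hc1]; decide
        · rw [hc2, hc5']; decide
        · rw [hc3]; decide
        · rw [hc4]; decide
        · rw [hc5']; decide
      rw [hsw]
      exact Or.inr (Or.inl isQuasiDecomposable_six₅)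
    · refine Or.inl (hs.isDecomposable_of_le isHodgeMultiset_six₅ (by decide) ?_ ?_)
      · refine Multiset.le_iff_count.2 fun a ↦ ?_
        rcases hcases a with rfl | rfl | rfl | rfl | rfl | rfl
        · rw [show count (0 : ZMod 6) ({5, 5, 2, 2, 2, 2} : Multiset (ZMod 6)) = 0 from by decide]; omega
        · rw [show count (1 : ZMod 6) ({5, 5, 2, 2, 2, 2} : Multiset (ZMod 6)) = 0 from by decide]; omega
        · rw [show count (2 : ZMod 6) ({5, 5, 2, 2, 2, 2} : Multiset (ZMod 6)) = 4 from by decide]; omega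
        · rw [show count (3 : ZMod 6) ({5, 5, 2, 2, 2, 2} : Multiset (ZMod 6)) = 0 from by decide]; omega
        · rw [show count (4 : ZMod 6) ({5, 5, 2, 2, 2, 2} : Multiset (ZMod 6)) = 0 from by decide]; omega
        · rw [show count (5 : ZMod 6) ({5, 5, 2, 2, 2, 2} : Multiset (ZMod 6)) = 2 from by decide]; omega
      · show 6 < card s
        omega
  -- (e) nothing left: `s ⊆ {3}` with at most one `3`, contradicting `#s ≥ 6`
  exfalso
  omega

end Six

end FermatCharacter

end Literature.AlgebraicGeometry.HodgeTheory

end
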